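import Mathlib

/-!
# Grid packing count

Helper for the crux `GappedShellCensus.CleanLimitsHaveWindows` (stmt-AtomisticToContinuum-15932), line
`Sketch`, stub `stub_gridCount`. Elementary packing fact used by the closing step of the line: for `1 ≤ G`
and `8 G ≤ L`, the closed ball `B̄(c, L/2)` of `ℝ³` contains at least `(L/(8G))³` points that are
pairwise at distance `≥ 2G`. Construction: with `M := ⌊L/(8G)⌋₊`, take the `(M+1)³` grid points
`c + 2G·(f 0, f 1, f 2)` for `f : Fin 3 → {0, …, M}`. Distinct grid points differ by at least `1` in
some coordinate, hence are `≥ 2G` apart (`PiLp.dist_apply_le`); each lies within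
`2G·√3·M ≤ 2G·2·L/(8G) = L/2` of `c` (we compare squares: `3 M² ≤ 4 (L/(8G))²`); and
`(M+1)³ ≥ (L/(8G))³` because `L/(8G) < M + 1`.
-/

noncomputable section

namespace Summit.AtomisticToContinuum.Crystallization.Theorems.CleanHull

/-- Coordinates of the grid point `c + (2G) • (f 0, f 1, f 2)`. [folklore] -/
theorem gridPt_apply (c : EuclideanSpace ℝ (Fin 3)) (G : ℝ) (f : Fin 3 → ℕ) (t : Fin 3) :
    (c + (2 * G) • WithLp.toLp 2 (fun s => (f s : ℝ))) t = c t + 2 * G * f t := by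
  simp

/-- Two grid points with distinct index functions are at distance `≥ 2G` (for `0 ≤ G`): they differ by
at least `2G · 1` in some coordinate. [folklore] -/
theorem gridPt_sep (c : EuclideanSpace ℝ (Fin 3)) {G : ℝ} (hG : 0 ≤ G) {f g : Fin 3 → ℕ}
    (hfg : f ≠ g) :
    2 * G ≤ dist (c + (2 * G) • WithLp.toLp 2 (fun s => (f s : ℝ)))
      (c + (2 * G) • WithLp.toLp 2 (fun s => (g s : ℝ))) := by
  obtain ⟨t, ht⟩ := Function.ne_iff.mp hfg
  have h1 : (1 : ℝ) ≤ |(f t : ℝ) - (g t : ℝ)| := by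
    rcases Nat.lt_or_gt_of_ne ht with h | h
    · have h' : (f t : ℝ) + 1 ≤ g t := by exact_mod_cast Nat.lt_iff_add_one_le.mp h
      rw [abs_sub_comm, abs_of_nonneg (by linarith)]
      linarith
    · have h' : (g t : ℝ) + 1 ≤ f t := by exact_mod_cast Nat.lt_iff_add_one_le.mp h
      rw [abs_of_nonneg (by linarith)]
      linarith
  calc 2 * G = 2 * G * 1 := by ring
    _ ≤ 2 * G * |(f t : ℝ) - (g t : ℝ)| := mul_le_mul_of_nonneg_left h1 (by positivity)
    _ = dist ((c + (2 * G) • WithLp.toLp 2 (fun s => (f s : ℝ))) t)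
          ((c + (2 * G) • WithLp.toLp 2 (fun s => (g s : ℝ))) t) := by
        rw [gridPt_apply, gridPt_apply, Real.dist_eq, add_sub_add_left_eq_sub, ← mul_sub, abs_mul,
          abs_of_nonneg (by positivity : (0 : ℝ) ≤ 2 * G)]
    _ ≤ _ := PiLp.dist_apply_le _ _ t

/-- A grid point with indices `≤ M` lies in the closed ball `B̄(c, L/2)` once `M ≤ L/(8G)`:
its offset from `c` has norm `2G ‖(f 0, f 1, f 2)‖ ≤ 2G · 2 · L/(8G) = L/2`, because
`‖(f 0, f 1, f 2)‖² ≤ 3 M² ≤ 4 (L/(8G))²`. [folklore] -/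
theorem gridPt_mem_closedBall (c : EuclideanSpace ℝ (Fin 3)) {G L : ℝ} (hG : 0 < G) {M : ℕ}
    (hM : (M : ℝ) ≤ L / (8 * G)) {f : Fin 3 → ℕ} (hf : ∀ t, f t ≤ M) :
    c + (2 * G) • WithLp.toLp 2 (fun s => (f s : ℝ)) ∈ Metric.closedBall c (L / 2) := by
  set v : EuclideanSpace ℝ (Fin 3) := WithLp.toLp 2 (fun s => (f s : ℝ)) with hv
  have hx0 : 0 ≤ L / (8 * G) := le_trans (Nat.cast_nonneg M) hM
  have hvt : ∀ t, (v t) ^ 2 ≤ (L / (8 * G)) ^ 2 := by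
    intro t
    have h0 : (0 : ℝ) ≤ v t := by simp [hv, PiLp.toLp_apply]
    have h1 : v t ≤ L / (8 * G) := by
      have : (f t : ℝ) ≤ M := by exact_mod_cast hf t
      simpa [hv, PiLp.toLp_apply] using this.trans hM
    exact pow_le_pow_left₀ h0 h1 2
  have hnorm : ‖v‖ ≤ 2 * (L / (8 * G)) := by
    rw [← sq_le_sq₀ (norm_nonneg v) (by linarith), EuclideanSpace.real_norm_sq_eq, Fin.sum_univ_three]
    nlinarith [hvt 0, hvt 1, hvt 2, sq_nonneg (L / (8 * G))]
  rw [Metric.mem_closedBall, dist_eq_norm, add_sub_cancel_left, norm_smul, Real.norm_eq_abs,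
    abs_of_pos (by positivity : (0 : ℝ) < 2 * G)]
  calc 2 * G * ‖v‖ ≤ 2 * G * (2 * (L / (8 * G))) := mul_le_mul_of_nonneg_left hnorm (by positivity)
    _ = L / 2 := by
        field_simp
        ring

/-- **Stub (grid packing count).** For `1 ≤ G` and `8 G ≤ L`, the closed ball `B̄(c, L/2)` of `ℝ³`
contains a finite set of at least `(L/(8G))³` points that are pairwise at distance `≥ 2G`: the
`(M+1)³` grid points `c + 2G·(f 0, f 1, f 2)`, `f : Fin 3 → {0, …, M}`, `M := ⌊L/(8G)⌋₊`. [folklore] -/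
theorem stub_gridCount (G L : ℝ) (hG : 1 ≤ G) (hL : 8 * G ≤ L) (c : EuclideanSpace ℝ (Fin 3)) :
    ∃ P : Finset (EuclideanSpace ℝ (Fin 3)), (↑P : Set (EuclideanSpace ℝ (Fin 3))) ⊆ Metric.closedBall c (L / 2) ∧
      (∀ y ∈ P, ∀ y' ∈ P, y ≠ y' → 2 * G ≤ dist y y') ∧ (L / (8 * G)) ^ 3 ≤ (P.card : ℝ) := by
  classical
  have hGpos : 0 < G := by linarith
  have hx1 : 1 ≤ L / (8 * G) := by
    rw [le_div_iff₀ (by positivity)]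
    linarith
  have hx0 : 0 ≤ L / (8 * G) := by linarith
  obtain ⟨M, hMx, hxM⟩ : ∃ M : ℕ, (M : ℝ) ≤ L / (8 * G) ∧ L / (8 * G) < M + 1 :=
    ⟨_, Nat.floor_le hx0, Nat.lt_floor_add_one _⟩
  have hFinj : Function.Injective
      (fun f : Fin 3 → ℕ => c + (2 * G) • WithLp.toLp 2 (fun s => (f s : ℝ))) := by
    intro f g hfg
    by_contra hne
    have h := gridPt_sep c hGpos.le hne
    dsimp only at hfg
    rw [hfg, dist_self] at h
    linarith
  refine ⟨(Fintype.piFinset fun _ : Fin 3 => Finset.range (M + 1)).image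
      (fun f : Fin 3 → ℕ => c + (2 * G) • WithLp.toLp 2 (fun s => (f s : ℝ))), ?_, ?_, ?_⟩
  · intro y hy
    obtain ⟨f, hf, rfl⟩ := Finset.mem_image.mp (Finset.mem_coe.mp hy)
    have hf' : ∀ t, f t ≤ M := fun t =>
      Nat.lt_succ_iff.mp (Finset.mem_range.mp (Fintype.mem_piFinset.mp hf t))
    exact gridPt_mem_closedBall c hGpos hMx hf'
  · intro y hy y' hy' hne
    obtain ⟨f, hf, rfl⟩ := Finset.mem_image.mp hy
    obtain ⟨g, hg, rfl⟩ := Finset.mem_image.mp hy'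
    have hfg : f ≠ g := fun h => hne (by rw [h])
    exact gridPt_sep c hGpos.le hfg
  · rw [Finset.card_image_of_injective _ hFinj, Fintype.card_piFinset_const, Finset.card_range]
    push_cast
    exact pow_le_pow_left₀ hx0 hxM.le 3

end Summit.AtomisticToContinuum.Crystallization.Theorems.CleanHull
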